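import Summits.Parity.GeneralizedHardyLittlewood.Theorems.LiouvilleShiftedTablesSieveToMAvgMAvgBound

/-!
# Sieve glue for `SieveToMAvg`, part 12a: the parameter functions of the height `Y`

Support file for item stmt-Parity-14274 (route `LiouvilleShiftedTables`).  For the final assembly all
auxiliary parameters are explicit functions of the height `Y` (and of a fixed exponent `A₁`):

* `Δf A₁ Y = (log Y)^{−A₁}` — the slicing ratio (fine pieces in `a`, `r`, `s`);
* `Kff A₁ Y = ⌈log 2Y / log(1+Δ)⌉ + 1` — number of fine pieces, `2Y ≤ (1+Δ)^{Kff}`, `Kff ≤ 2 log(2Y)(log Y)^{A₁} + 2`;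
* `Kbf Y = log₂⌊Y⌋ + 2` — number of dyadic boxes, `Y < 2^{Kbf}`, `Kbf ≤ 2 log Y + 2`;
* `k0f Y = ⌈log₂ (log Y)^{13}⌉` — dyadic depth, `(log Y)^{13} ≤ 2^{k0f} ≤ 2 (log Y)^{13}`.
-/

namespace Summit.Parity.GeneralizedHardyLittlewood.Theorems.SieveToMAvg

open Finset Real
open scoped ArithmeticFunction.zeta ArithmeticFunction.sigma ArithmeticFunction.vonMangoldt

/-! ### The slicing ratio -/

/-- `Δ(Y) = (log Y)^{−A₁}`. [folklore] -/
noncomputable def Δf (A₁ : ℕ) (Y : ℝ) : ℝ := (Real.log Y ^ A₁)⁻¹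

/-- `0 < Δ(Y) ≤ 1/2` once `(log Y)^{A₁} ≥ 2`. [folklore] -/
theorem Δf_bounds {A₁ : ℕ} {Y : ℝ} (hL : 2 ≤ Real.log Y ^ A₁) : 0 < Δf A₁ Y ∧ Δf A₁ Y ≤ 1 / 2 := by
  unfold Δf
  refine ⟨by positivity, ?_⟩
  rw [inv_eq_one_div, div_le_div_iff₀ (by linarith) (by norm_num)]
  linarith

/-- `log(1 + Δ) ≥ Δ/2` for `0 < Δ ≤ 1`. [folklore] -/
theorem half_le_log_one_add {Δ : ℝ} (h0 : 0 < Δ) (h1 : Δ ≤ 1) : Δ / 2 ≤ Real.log (1 + Δ) := by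
  have h := Real.one_sub_inv_le_log_of_pos (by linarith : (0 : ℝ) < 1 + Δ)
  have h2 : Δ / 2 ≤ 1 - (1 + Δ)⁻¹ := by
    rw [inv_eq_one_div, sub_div' (by linarith), le_div_iff₀ (by linarith)]
    nlinarith
  exact h2.trans h

/-! ### The number of fine pieces -/

/-- `Kff A₁ Y = ⌈log(2Y)/log(1+Δ(Y))⌉ + 1`. [folklore] -/
noncomputable def Kff (A₁ : ℕ) (Y : ℝ) : ℕ := ⌈Real.log (2 * Y) / Real.log (1 + Δf A₁ Y)⌉₊ + 1

/-- `2Y ≤ (1+Δ)^{Kff}` (`Y ≥ 1/2`, `Δ > 0`). [folklore] -/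
theorem two_mul_le_pow_Kff {A₁ : ℕ} {Y : ℝ} (hY : 1 / 2 ≤ Y) (hΔ : 0 < Δf A₁ Y) :
    2 * Y ≤ (1 + Δf A₁ Y) ^ Kff A₁ Y := by
  set Δ := Δf A₁ Y with hΔdef
  set t := Real.log (2 * Y) / Real.log (1 + Δ) with ht
  have hb : 1 < 1 + Δ := by linarith
  have hlog : 0 < Real.log (1 + Δ) := Real.log_pos hb
  have ht0 : 0 ≤ t := div_nonneg (Real.log_nonneg (by linarith)) hlog.le
  have heq : (1 + Δ) ^ t = 2 * Y := by
    rw [Real.rpow_def_of_pos (by linarith), ht, show Real.log (1 + Δ) * (Real.log (2 * Y) / Real.log (1 + Δ)) =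
      Real.log (2 * Y) by field_simp, Real.exp_log (by linarith)]
  calc 2 * Y = (1 + Δ) ^ t := heq.symm
    _ ≤ (1 + Δ) ^ ((Kff A₁ Y : ℕ) : ℝ) := by
        refine Real.rpow_le_rpow_of_exponent_le hb.le ?_
        show t ≤ ((⌈t⌉₊ + 1 : ℕ) : ℝ)
        push_cast
        linarith [Nat.le_ceil t]
    _ = (1 + Δ) ^ Kff A₁ Y := Real.rpow_natCast _ _

/-- `Kff ≤ 2 log(2Y) (log Y)^{A₁} + 2` (`Y ≥ 1/2`, `0 < Δ ≤ 1`). [folklore] -/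
theorem Kff_le {A₁ : ℕ} {Y : ℝ} (hY : 1 / 2 ≤ Y) (hΔ : 0 < Δf A₁ Y) (hΔ1 : Δf A₁ Y ≤ 1) :
    (Kff A₁ Y : ℝ) ≤ 2 * Real.log (2 * Y) * Real.log Y ^ A₁ + 2 := by
  set Δ := Δf A₁ Y with hΔdef
  have hlog2Y : 0 ≤ Real.log (2 * Y) := Real.log_nonneg (by linarith)
  have hl : Δ / 2 ≤ Real.log (1 + Δ) := half_le_log_one_add hΔ hΔ1
  have hlpos : 0 < Real.log (1 + Δ) := lt_of_lt_of_le (by linarith) hl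
  have ht : Real.log (2 * Y) / Real.log (1 + Δ) ≤ 2 * Real.log (2 * Y) * Real.log Y ^ A₁ := by
    rw [div_le_iff₀ hlpos]
    have hL : 0 < Real.log Y ^ A₁ := by
      have : Δ = (Real.log Y ^ A₁)⁻¹ := rfl
      rw [this] at hΔ; exact inv_pos.1 hΔ
    have hΔL : Δ * Real.log Y ^ A₁ = 1 := by
      rw [show Δ = (Real.log Y ^ A₁)⁻¹ from rfl, inv_mul_cancel₀ hL.ne']
    calc Real.log (2 * Y) = Real.log (2 * Y) * (Δ * Real.log Y ^ A₁) := by rw [hΔL, mul_one]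
      _ = 2 * Real.log (2 * Y) * Real.log Y ^ A₁ * (Δ / 2) := by ring
      _ ≤ 2 * Real.log (2 * Y) * Real.log Y ^ A₁ * Real.log (1 + Δ) :=
          mul_le_mul_of_nonneg_left hl (by positivity)
  unfold Kff
  push_cast
  have hceil := (Nat.ceil_lt_add_one (div_nonneg hlog2Y hlpos.le)).le
  linarith

/-! ### The number of dyadic boxes -/

/-- `Kbf Y = log₂⌊Y⌋ + 2`. [folklore] -/
noncomputable def Kbf (Y : ℝ) : ℕ := Nat.log 2 ⌊Y⌋₊ + 2

/-- `2x < 2^{Kbf Y}` for `2x ≤ Y`. [folklore] -/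
theorem lt_two_pow_Kbf {x Y : ℝ} (hxY : 2 * x ≤ Y) : 2 * x < (2 : ℝ) ^ Kbf Y := by
  have h1 : ⌊Y⌋₊ < 2 ^ (Nat.log 2 ⌊Y⌋₊ + 1) := Nat.lt_pow_succ_log_self (by norm_num) _
  have h2 : Y < ⌊Y⌋₊ + 1 := Nat.lt_floor_add_one Y
  have h3 : ((⌊Y⌋₊ + 1 : ℕ) : ℝ) ≤ (2 : ℝ) ^ (Nat.log 2 ⌊Y⌋₊ + 1) := by exact_mod_cast h1
  unfold Kbf
  calc 2 * x ≤ Y := hxY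
    _ < (⌊Y⌋₊ : ℝ) + 1 := h2
    _ = ((⌊Y⌋₊ + 1 : ℕ) : ℝ) := by push_cast; ring
    _ ≤ (2 : ℝ) ^ (Nat.log 2 ⌊Y⌋₊ + 1) := h3
    _ ≤ (2 : ℝ) ^ (Nat.log 2 ⌊Y⌋₊ + 2) := pow_le_pow_right₀ (by norm_num) (by omega)

/-- `Kbf Y ≤ 2 log Y + 2` for `Y ≥ 1`. [folklore] -/
theorem Kbf_le {Y : ℝ} (hY : 1 ≤ Y) : (Kbf Y : ℝ) ≤ 2 * Real.log Y + 2 := by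
  unfold Kbf
  push_cast
  have hfl : 1 ≤ ⌊Y⌋₊ := Nat.le_floor (by simpa using hY)
  have h1 : ((2 : ℕ) : ℝ) ^ Nat.log 2 ⌊Y⌋₊ ≤ ⌊Y⌋₊ := by exact_mod_cast Nat.pow_log_le_self 2 (by omega)
  have h2 : (Nat.log 2 ⌊Y⌋₊ : ℝ) * Real.log 2 ≤ Real.log Y := by
    have := Real.log_le_log (by positivity) (h1.trans (Nat.floor_le (by linarith)))
    rwa [Nat.cast_ofNat, Real.log_pow] at this
  have hlog2 : (1 : ℝ) / 2 ≤ Real.log 2 := by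
    have := Real.log_two_gt_d9; linarith
  have h3 : (Nat.log 2 ⌊Y⌋₊ : ℝ) ≤ 2 * Real.log Y := by
    have h0 : (0 : ℝ) ≤ Nat.log 2 ⌊Y⌋₊ := Nat.cast_nonneg _
    nlinarith
  linarith

/-! ### The dyadic depth -/

/-- `k0f Y = ⌈log₂ (log Y)^{13}⌉`. [folklore] -/
noncomputable def k0f (Y : ℝ) : ℕ := ⌈Real.logb 2 (Real.log Y ^ 13)⌉₊

/-- `(log Y)^{13} ≤ 2^{k0f Y} ≤ 2 (log Y)^{13}` for `log Y ≥ 1`. [folklore] -/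
theorem two_pow_k0f_bounds {Y : ℝ} (hL : 1 ≤ Real.log Y) :
    Real.log Y ^ 13 ≤ (2 : ℝ) ^ k0f Y ∧ (2 : ℝ) ^ k0f Y ≤ 2 * Real.log Y ^ 13 := by
  set s := Real.logb 2 (Real.log Y ^ 13) with hs
  have hpos : 0 < Real.log Y ^ 13 := by positivity
  have hs0 : 0 ≤ s := Real.logb_nonneg (by norm_num) (one_le_pow₀ hL)
  have heq : (2 : ℝ) ^ s = Real.log Y ^ 13 := Real.rpow_logb (by norm_num) (by norm_num) hpos
  have hk : s ≤ (k0f Y : ℝ) ∧ (k0f Y : ℝ) < s + 1 := by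
    unfold k0f; exact ⟨Nat.le_ceil s, Nat.ceil_lt_add_one hs0⟩
  constructor
  · calc Real.log Y ^ 13 = (2 : ℝ) ^ s := heq.symm
      _ ≤ (2 : ℝ) ^ ((k0f Y : ℕ) : ℝ) := Real.rpow_le_rpow_of_exponent_le (by norm_num) hk.1
      _ = (2 : ℝ) ^ k0f Y := Real.rpow_natCast _ _
  · calc (2 : ℝ) ^ k0f Y = (2 : ℝ) ^ ((k0f Y : ℕ) : ℝ) := (Real.rpow_natCast _ _).symm
      _ ≤ (2 : ℝ) ^ (s + 1) := Real.rpow_le_rpow_of_exponent_le (by norm_num) hk.2.le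
      _ = 2 * Real.log Y ^ 13 := by rw [Real.rpow_add (by norm_num), heq, Real.rpow_one]; ring

/-- `k0f Y ≤ 13 log₂ log Y + 1` (`log Y ≥ 1`), in the form `k0f Y ≤ 13 · log(log Y)/log 2 + 1`. [folklore] -/
theorem k0f_le {Y : ℝ} (hL : 1 ≤ Real.log Y) : (k0f Y : ℝ) ≤ 13 * (Real.log (Real.log Y) / Real.log 2) + 1 := by
  have hs0 : 0 ≤ Real.logb 2 (Real.log Y ^ 13) := Real.logb_nonneg (by norm_num) (one_le_pow₀ hL)
  have hu : Real.logb 2 (Real.log Y ^ 13) = 13 * (Real.log (Real.log Y) / Real.log 2) := by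
    rw [Real.logb, Real.log_pow]; push_cast; ring
  have := (Nat.ceil_lt_add_one hs0).le
  unfold k0f
  rw [hu] at this ⊢
  exact this

/-- The dyadic scales: for `k < k0f Y`, `x_k = Y/2^{k+1}` satisfies `Y/(2 (log Y)^{13}) ≤ x_k` and `2x_k ≤ Y`
(`log Y ≥ 1`, `Y ≥ 0`). [folklore] -/
theorem dyadic_scale_bounds {Y : ℝ} (hY : 0 ≤ Y) (hL : 1 ≤ Real.log Y) {k : ℕ} (hk : k < k0f Y) :
    Y / (2 * Real.log Y ^ 13) ≤ Y / 2 ^ (k + 1) ∧ 2 * (Y / 2 ^ (k + 1)) ≤ Y := by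
  obtain ⟨_, h2⟩ := two_pow_k0f_bounds hL
  constructor
  · refine div_le_div_of_nonneg_left hY (by positivity) ?_
    calc (2 : ℝ) ^ (k + 1) ≤ 2 ^ k0f Y := pow_le_pow_right₀ (by norm_num) hk
      _ ≤ 2 * Real.log Y ^ 13 := h2
  · rw [pow_succ]
    have : (1 : ℝ) ≤ 2 ^ k := one_le_pow₀ (by norm_num)
    rw [mul_div_assoc']
    rw [div_le_iff₀ (by positivity)]
    nlinarith

/-- The initial segment height: `Y/2^{k0f Y} ≤ Y/(log Y)^{13}` (`log Y ≥ 1`, `Y ≥ 0`). [folklore] -/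
theorem init_height_le {Y : ℝ} (hY : 0 ≤ Y) (hL : 1 ≤ Real.log Y) : Y / 2 ^ k0f Y ≤ Y / Real.log Y ^ 13 :=
  div_le_div_of_nonneg_left hY (by positivity) (two_pow_k0f_bounds hL).1

end Summit.Parity.GeneralizedHardyLittlewood.Theorems.SieveToMAvg
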